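import Summits.NavierStokesRegularity.NavierStokesRegularity.Theorems.AxisymmetricExtremalityAxisymmetricKatoGlobalStubSeregin2020TypeIILemma22EnergyInequality
import HarnessLib

/-!
# Seregin 2020, Lemma 2.2 — piece L22-C: Nazarov–Uraltseva's «expansion of positivity»
# (N–U 2012, §3: Lemma 3.1, Cor 3.1(2), Lemma 3.2, Lemma 3.3, Cor 3.2, Lemma 3.4, Cor 3.3, with
# Remark 9) in a DE GIORGI CLASS formulation — SKELETON (seat ns-in-ser-c, 2026-08-28)

Crux `AxisymmetricExtremality.AxisymmetricKatoGlobal` (stmt-NavierStokesRegularity-15453), stub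
`stub_seregin2020TypeII` = named fact `Seregin2020_axisymmetricSingularPoint_typeII`. State of the
tree: the fact follows from Lemma 2.2 in the corrected rendering `hWH′` (the written-out hypothesis
of `blowupIndex_eq_top_of_weakHarnack'`, file `…Seregin2020TypeIISwirlVanishesV2Final`); everything
else (ancient limit, `Γ ≡ 0` from `hWH′`, no-swirl endgame) is LANDED. `hWH′` = N–U Lemma 4.2 in
Seregin's class 𝒱. Split (cell pub/ns-inputs, 2026-08-28): L22-A (seat a) = measure estimate
(4.5)–(4.8) + final assembly; L22-B (seat b) = energy inequality ACROSS the axis and `S`;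
L22-C (this file, seat c) = Cor 3.3′ «expansion of positivity» from L22-B.

DESIGN. The analytic lemmas below never see the Navier–Stokes data, the axis condition or the
singular set `S` except through:
* `Measurable (uncurry Φ)` — WLOG: every clause of `hWH′` is stated off `S` or a.e., so `Φ` may be
  normalised on the (closed, Lebesgue-null) set `S` (e.g. `Φ := k` on `S`), after which it is Borel;
* `ContinuousOn (uncurry Φ) ({t < 0} ∖ S)`, `S` closed, `S ⊆ {x' = 0}` — used only to upgrade
  «a.e. on an open cylinder» to «a.e. on every time slice up to the top time» (N–U have Lipschitz `V`);
* a.e.-`t` slice regularity `ContDiff ℝ 1 (Φ t)` — from class 𝒱 and the fact that the TIME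
  PROJECTION of a `𝒫¹`-null set is Lebesgue-null (`ae_forall_not_mem_of_isParabolicNull`), so for
  a.e. `t` the slice `S_t` is empty;
* the drift bound `∫_{-R²}^0 (∫_{B(2R)} |U|³)^{4/3} ≤ N R²` (N–U: `q = 3`, `ℓ = 4`, `α = 1/2`; the
  singular drift `2x'/|x'|²` is explicit, `L_{q,∞}`, `q < 2`, N–U Remark 5);
* the ENERGY INEQUALITY CLASS `hDG` (target of L22-B): the landed
  `supersolution_energy_ineq_offAxis_absorbed` with the restriction `tsupport Θ ⊆ O`, `O` off the
  axis, REMOVED (cut-offs may meet the axis and `S`), for `H ∈ C²`, `H' ≤ 0 ≤ H, H''`,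
  `H'² ≤ 2HH''`, `H = 0` on `[k, ∞)` (this is how N–U's Remark 9 «`V ≥ k` on the axis» enters:
  only levels `l ≤ k` are ever tested), dissipation as a `lintegral`, slab form.

Nothing here is new mathematics; no NS regularity statement is touched.

## References
* A. I. Nazarov, N. N. Uraltseva, St. Petersburg Math. J. 23 (2012) 93–115 = arXiv:1011.1888, §3
  (Lemmas 3.1–3.4, Corollaries 3.1–3.3, Remarks 5, 6, 9), §4 Lemma 4.2. [NazarovUraltseva2012]
* G. Seregin, Anal. Math. Phys. 10 (2020) 46 = arXiv:2006.04140, Lemma 2.2. [Seregin2020]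
-/

set_option linter.dupNamespace false
set_option linter.unusedVariables false

noncomputable section

open MeasureTheory Set Function Filter Topology TopologicalSpace Metric
open scoped NNReal ENNReal

namespace Summit.NavierStokesRegularity.NavierStokesRegularity.Cruxes.AxisymmetricKatoGlobal.Seregin2020Lemma22

open Literature.Analysis.FluidPDE Literature.Analysis.FluidPDE.Seregin2020

local notation "E3" => EuclideanSpace ℝ (Fin 3)

/-! ### The standing hypotheses (written out in every landed theorem; `def`s only in this skeleton) -/

/-- **The energy-inequality class on the slab `]-R², 0[ × B(2R)` at the axis level `k`** (the
statement seat b lands as L22-B, «across the axis and `S`»): for every `H ∈ C²(ℝ)` with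
`H' ≤ 0 ≤ H`, `H'' ≥ 0`, `H'² ≤ 2HH''` and `H = 0` on `[k,∞)`, every `Θ ∈ C¹_c` with
`tsupport Θ ⊆ B(2R)` (meeting the axis or not), every `η ∈ C¹`, `η ≥ 0`, and all
`-R² < t₁ ≤ t₂ < 0`:
`η(t₂)M(t₂) + ½∫∫ η H''(Φ)|∇Φ|²Θ² ≤ η(t₁)M(t₁) + ∫∫ (4ηH(Φ)|∇Θ|² + ηH(Φ)⟪U,∇Θ²⟫ + η(2/ϱ)H(Φ)∂_ϱΘ² + |η'|H(Φ)Θ²)`,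
`M(t) = ∫ H(Φ(t,x))Θ(x)² dx`, the dissipation as a `lintegral` (its finiteness is part of the
content), the four right-hand terms as SEPARATE Bochner integrals over the slab (so that a consumer
can bound each from above without an integrability certificate). PARSING NOTE (v3, 2026-08-28):
the slice integral `(∫ x, H (Φ t₁ x) * Θ x ^ 2)` MUST be parenthesised — `∫ x, a + b` parses as
`∫ x, (a + b)`; v1/v2 of this skeleton and the first registration of the stubs had it unparenthesised
(a vacuous class); the stubs were re-registered with this text. [cite: NazarovUraltseva2012, §3 (3.2), (3.9) with Remark 9] -/
def EnergyClass (Φ : ℝ → E3 → ℝ) (U : ℝ → E3 → E3) (k R : ℝ) : Prop :=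
  ∀ (H : ℝ → ℝ), ContDiff ℝ 2 H → (∀ v, deriv H v ≤ 0) → (∀ v, 0 ≤ H v) →
    (∀ v, 0 ≤ deriv (deriv H) v) → (∀ v, deriv H v ^ 2 ≤ 2 * H v * deriv (deriv H) v) →
    (∀ v, k ≤ v → H v = 0) →
  ∀ (Θ : E3 → ℝ), ContDiff ℝ 1 Θ → HasCompactSupport Θ → tsupport Θ ⊆ ball (0 : E3) (2 * R) →
  ∀ (η : ℝ → ℝ), ContDiff ℝ 1 η → (∀ s, 0 ≤ η s) →
  ∀ (t₁ t₂ : ℝ), -R ^ 2 < t₁ → t₁ ≤ t₂ → t₂ < 0 →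
    ENNReal.ofReal (η t₂ * ∫ x, H (Φ t₂ x) * Θ x ^ 2) +
      ∫⁻ z in Icc t₁ t₂ ×ˢ (univ : Set E3), ENNReal.ofReal
        (1 / 2 * η z.1 * (deriv (deriv H) (Φ z.1 z.2) * ‖gradient (Φ z.1) z.2‖ ^ 2 * Θ z.2 ^ 2))
    ≤ ENNReal.ofReal (η t₁ * (∫ x, H (Φ t₁ x) * Θ x ^ 2) +
        (4 * ∫ z in Icc t₁ t₂ ×ˢ (univ : Set E3), η z.1 * (H (Φ z.1 z.2) * ‖gradient Θ z.2‖ ^ 2)) +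
        (∫ z in Icc t₁ t₂ ×ˢ (univ : Set E3),
          η z.1 * (H (Φ z.1 z.2) * inner ℝ (U z.1 z.2) (gradient (fun y => Θ y ^ 2) z.2))) +
        (∫ z in Icc t₁ t₂ ×ˢ (univ : Set E3),
          η z.1 * (2 / cylRadius z.2 * (H (Φ z.1 z.2) * fderiv ℝ (fun y => Θ y ^ 2) z.2 (eR z.2)))) +
        (∫ z in Icc t₁ t₂ ×ˢ (univ : Set E3), |deriv η z.1| * (H (Φ z.1 z.2) * Θ z.2 ^ 2)))

/-- **Standing hypotheses of the De Giorgi chain** at scale `R` and axis level `k` with drift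
constant `N`: measurability (after normalisation on `S`), continuity off the closed axis set `S`,
nonnegativity, a.e.-`t` `C¹` slices, the drift bound `∫_{-R²}^0 (∫_{B(2R)} |U|³)^{4/3} ≤ N R²`
(N–U `q = 3, ℓ = 4, α = ½`), and the energy class. [cite: NazarovUraltseva2012, §3 and Lemma 4.2] -/
def Standing (Φ : ℝ → E3 → ℝ) (U : ℝ → E3 → E3) (S : Set (ℝ × E3)) (k R : ℝ) (N : ℝ≥0) : Prop :=
  0 < k ∧ 0 < R ∧ Measurable (uncurry Φ) ∧ AEStronglyMeasurable (uncurry U) volume ∧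
  IsClosed S ∧ (∀ z ∈ S, cylRadius z.2 = 0) ∧
  ContinuousOn (uncurry Φ) ({z : ℝ × E3 | z.1 < 0} \ S) ∧
  (∀ t x, 0 ≤ Φ t x) ∧
  (∀ᵐ t : ℝ, t ∈ Ioo (-R ^ 2) 0 → ContDiff ℝ 1 (Φ t)) ∧
  (∫⁻ s in Ioo (-R ^ 2) 0, (∫⁻ y in ball (0 : E3) (2 * R), ‖U s y‖ₑ ^ (3 : ℕ)) ^ (4 / 3 : ℝ)
      ≤ (N : ℝ≥0∞) * ENNReal.ofReal R ^ 2) ∧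
  EnergyClass Φ U k R

/-! STATUS 08:50Z: `lemma22_shrinking` (p617331) and `lemma22_densityPropagation` (p618141) are
LANDED by seat b; L3.1′ is split into M1 `lemma22_moserStep` (below, handed to wu-p33 g2) and M2
(the iteration, seat c) which proves `lemma22_smallSublevel_lowerBound` from M1. -/

/-! ### The analytic atoms (stubs — REGISTERED on stmt-NavierStokesRegularity-15453 under these names,
2026-08-28, with `Standing`/`EnergyClass` written out; land each as
`theorem <name> : <signature>` in its own Theorems file `--supports stmt-NavierStokesRegularity-15453`)

STATUS 2026-08-28 (seat ns-in-ser-c): the COMPOSITION below is LANDED —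
`Theorems/…Seregin2020TypeIILemma22ExpansionStep.lean` (p612405: `ae_ball_le_of_ae_cylinder_le`,
`exists_mem_Ioo_lt_volume_slice`, `chain_step` = N–U Cor 3.2 (2)),
`…Lemma22ExpansionChain.lean` (p613205: `chain_lowerBound` = N–U Lemma 3.4),
`…Lemma22ExpansionOfPositivity.lean` (p613761: `expansionOfPositivity_of_atoms` = Cor 3.3′ from the
three atoms as hypotheses). What remains of L22-C: the three atoms themselves.

Geometry: N–U's `Q_ρ^{λ,θ}(0; t⁰) = B(λρ) × ]t⁰ - θρ², t⁰[`, spatial centre always the origin (an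
axis point), `t⁰ ≤ 0`, everything inside the slab `]-R², 0[ × B(2R)`; radii comparable to `R`
(`R/4 ≤ ρ`), so all constants depend on `N` and the listed shape parameters only. -/

/-- **L3.1′+Cor 3.1′(2) with Remark 6 (local maximum estimate for `(l - Φ)₊`, De Giorgi–Moser),
stub.** For shape RANGES `λ ∈ [λlo, 2]` (`λlo > 1`), `θ ∈ [θlo, θhi]` and drift constant `N`
there is `μ₁ > 0` (uniform over the ranges: N–U's `N₄` is an explicit expression, monotone in
`(λ-1)⁻¹`, `θ⁻¹`, `θ`) such that, for every level `0 < l ≤ k`: if `{Φ < l}` occupies at most the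
fraction `μ₁` of `Q_ρ^{λ,θ}(0;t⁰)`, then (i) `Φ ≥ l/2` a.e. on `Q_ρ^{1,θ/2}(0;t⁰)`, and (ii) if moreover
`Φ(t⁰ - θρ², ·) ≥ l` a.e. on `B(λρ)`, then `Φ ≥ l/2` a.e. on `Q_ρ^{1,θ}(0;t⁰)`. (Moser iteration
`p_m = (5/3)^m` on `H = (l-τ)₊^{2p}` through `hDG`, parabolic embedding
`parabolicEmbedding_of_slice_bounds`, drift split as in N–U Remark 5.)
[cite: NazarovUraltseva2012, Lemma 3.1, Remark 6, Cor 3.1(2), Remark 9] -/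
theorem lemma22_smallSublevel_lowerBound :
    ∀ (lamlo θlo θhi : ℝ) (N : ℝ≥0), 1 < lamlo → lamlo ≤ 2 → 0 < θlo → θlo ≤ θhi →
    ∃ μ₁ : ℝ, 0 < μ₁ ∧
    ∀ (Φ : ℝ → E3 → ℝ) (U : ℝ → E3 → E3) (S : Set (ℝ × E3)) (k R : ℝ),
      Standing Φ U S k R N →
    ∀ (lam ρ θ t₀ l : ℝ), lamlo ≤ lam → lam ≤ 2 → R / 4 ≤ ρ → lam * ρ ≤ 2 * R → θlo ≤ θ → θ ≤ θhi →
      t₀ ≤ 0 → -R ^ 2 < t₀ - θ * ρ ^ 2 → 0 < l → l ≤ k →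
      volume {z : ℝ × E3 | z ∈ Ioo (t₀ - θ * ρ ^ 2) t₀ ×ˢ ball (0 : E3) (lam * ρ) ∧ Φ z.1 z.2 < l}
        ≤ ENNReal.ofReal μ₁ * volume (Ioo (t₀ - θ * ρ ^ 2) t₀ ×ˢ ball (0 : E3) (lam * ρ)) →
      (∀ᵐ z ∂(volume.restrict (Ioo (t₀ - θ / 2 * ρ ^ 2) t₀ ×ˢ ball (0 : E3) ρ)),
          l / 2 ≤ Φ z.1 z.2) ∧
      ((∀ᵐ x ∂(volume.restrict (ball (0 : E3) (lam * ρ))), l ≤ Φ (t₀ - θ * ρ ^ 2) x) →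
        ∀ᵐ z ∂(volume.restrict (Ioo (t₀ - θ * ρ ^ 2) t₀ ×ˢ ball (0 : E3) ρ)), l / 2 ≤ Φ z.1 z.2) := by
  sorry

/-- **M1 = `lemma22_moserStep` (one reverse-Hölder step of the Moser iteration, N–U (3.2)–(3.6)
for a single `m`), stub; the 2-way split of L3.1′ (seat c keeps M2 = the iteration).** In the energy
class, for the test power `H = ((l-τ)₊)^q` with ANY real `q > 2` (constants uniform in `q`: 
`H''|∇Φ|² = (4(q-1)/q)|∇(l-Φ)₊^{q/2}|² ≥ 2|∇v|²`), a level `0 < l ≤ k`, and nested cylinders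
`Q′ = ]t₀-Θ₂ρ², t₀[ × B(Λ₂ρ) ⊂ Q = ]t₀-Θ₁ρ², t₀[ × B(Λ₁ρ)` with gaps `dl = Λ₁-Λ₂`, `dθ = Θ₁-Θ₂`
in `]0,1]`: (i) `∫∫_{Q′} (l-Φ)₊^{5q/3} ≤ C₀ (dl·dθ)^{-A} ρ^{-10/3} (∫∫_Q (l-Φ)₊^q)^{5/3}`;
(ii) (N–U Remark 6) if `l ≤ Φ(t₀-Θ₁ρ², ·)` a.e. on `B(Λ₁ρ)`, the same on the FULL window
`]t₀-Θ₁ρ², t₀[ × B(Λ₂ρ)` with constant `C₀ dl^{-A}`. `C₀, A ≥ 0` depend on `N`, `Θmax` only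
(energy inequality + drift absorption N–U (3.3)–(3.5) with Remark 5 for `2x'/|x'|²` + parabolic
embedding `L^∞L² ∩ L²H¹ → L^{10/3}`, `parabolicEmbedding_of_slice_bounds`).
[cite: NazarovUraltseva2012, Lemma 3.1, (3.2)–(3.6), Remarks 5, 6, 9] -/
theorem lemma22_moserStep :
    ∀ (N : ℝ≥0) (Θmax : ℝ), 0 < Θmax →
    ∃ C₀ A : ℝ, 0 ≤ C₀ ∧ 0 ≤ A ∧
    ∀ (Φ : ℝ → E3 → ℝ) (U : ℝ → E3 → E3) (S : Set (ℝ × E3)) (k R : ℝ),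
      Standing Φ U S k R N →
    ∀ (ρ Λ₁ Λ₂ Θ₁ Θ₂ dl dθ t₀ l q : ℝ), R / 4 ≤ ρ → 1 ≤ Λ₂ → Λ₂ + dl ≤ Λ₁ → Λ₁ * ρ ≤ 2 * R →
      0 < dl → dl ≤ 1 → 0 < Θ₂ → Θ₂ + dθ ≤ Θ₁ → Θ₁ ≤ Θmax → 0 < dθ → dθ ≤ 1 →
      t₀ ≤ 0 → -R ^ 2 < t₀ - Θ₁ * ρ ^ 2 → 0 < l → l ≤ k → 2 < q →
      (∫⁻ z in Ioo (t₀ - Θ₂ * ρ ^ 2) t₀ ×ˢ ball (0 : E3) (Λ₂ * ρ),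
          ENNReal.ofReal (max (l - Φ z.1 z.2) 0 ^ (5 / 3 * q))
        ≤ ENNReal.ofReal (C₀ * (dl * dθ) ^ (-A) * ρ ^ (-(10 / 3 : ℝ))) *
          (∫⁻ z in Ioo (t₀ - Θ₁ * ρ ^ 2) t₀ ×ˢ ball (0 : E3) (Λ₁ * ρ),
            ENNReal.ofReal (max (l - Φ z.1 z.2) 0 ^ q)) ^ (5 / 3 : ℝ)) ∧
      ((∀ᵐ x ∂(volume.restrict (ball (0 : E3) (Λ₁ * ρ))), l ≤ Φ (t₀ - Θ₁ * ρ ^ 2) x) →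
        ∫⁻ z in Ioo (t₀ - Θ₁ * ρ ^ 2) t₀ ×ˢ ball (0 : E3) (Λ₂ * ρ),
            ENNReal.ofReal (max (l - Φ z.1 z.2) 0 ^ (5 / 3 * q))
          ≤ ENNReal.ofReal (C₀ * dl ^ (-A) * ρ ^ (-(10 / 3 : ℝ))) *
            (∫⁻ z in Ioo (t₀ - Θ₁ * ρ ^ 2) t₀ ×ˢ ball (0 : E3) (Λ₁ * ρ),
              ENNReal.ofReal (max (l - Φ z.1 z.2) 0 ^ q)) ^ (5 / 3 : ℝ)) := by
  sorry

/-- **L3.2′ (propagation of density forward in time), stub.** For `δ₀ ∈ ]0,1]` and `N` there is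
`θ₀ ∈ ]0,1[` such that for every window `θ ∈ ]0, θ₀]` and level `0 < κ ≤ k`: if
`|{Φ(t⁰ - θρ², ·) ≥ κ} ∩ B(ρ)| ≥ δ₀|B(ρ)|` then `|{Φ(t̄, ·) ≥ δ₀κ/3} ∩ B(ρ)| ≥ (δ₀/3)|B(ρ)|` for
every `t̄ ∈ [t⁰ - θρ², t⁰]`, `t̄ < 0`. (Energy inequality for `(Φ - κ)₋²` — `H = (κ-τ)₊²`
smoothed, through `hDG` — with `ζ = 1` on `B((1-σ)ρ)`, Chebyshev on the slice `t̄`; the window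
monotonicity `θ ≤ θ₀` is free in N–U's proof.) [cite: NazarovUraltseva2012, Lemma 3.2, Remark 9] -/
theorem lemma22_densityPropagation :
    ∀ (δ₀ : ℝ) (N : ℝ≥0), 0 < δ₀ → δ₀ ≤ 1 →
    ∃ θ₀ : ℝ, 0 < θ₀ ∧ θ₀ < 1 ∧
    ∀ (Φ : ℝ → E3 → ℝ) (U : ℝ → E3 → E3) (S : Set (ℝ × E3)) (k R : ℝ),
      Standing Φ U S k R N →
    ∀ (ρ θ t₀ κ : ℝ), R / 4 ≤ ρ → ρ ≤ 2 * R → 0 < θ → θ ≤ θ₀ →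
      t₀ ≤ 0 → -R ^ 2 < t₀ - θ * ρ ^ 2 → 0 < κ → κ ≤ k →
      ENNReal.ofReal δ₀ * volume (ball (0 : E3) ρ)
        ≤ volume {x : E3 | x ∈ ball (0 : E3) ρ ∧ κ ≤ Φ (t₀ - θ * ρ ^ 2) x} →
      ∀ t ∈ Icc (t₀ - θ * ρ ^ 2) t₀, t < 0 →
        ENNReal.ofReal (δ₀ / 3) * volume (ball (0 : E3) ρ)
          ≤ volume {x : E3 | x ∈ ball (0 : E3) ρ ∧ δ₀ * κ / 3 ≤ Φ t x} := by
  sorry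

/-- **L3.3′ (shrinking lemma, De Giorgi), stub.** For shape ranges `λ ∈ [λlo, 2]` (`λlo > 1`),
`θ ∈ [θlo, θhi]`, a target fraction `μ ∈ ]0,1[`, a density `δ₁ > 0` and `N` there is `s ∈ ℕ`
(uniform over the ranges) such that for every level `0 < κ₀ ≤ k`: if `|{Φ(t,·) ≥ κ₀} ∩ B(ρ)| ≥ δ₁|B(ρ)|` for a.e.
`t ∈ ]t⁰ - θρ², t⁰[`, then `{Φ < 2^{-s}κ₀}` occupies at most the fraction `μ` of `Q_ρ^{1,θ}(0;t⁰)`.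
(Energy inequality for `(Φ - k_m)₋²`, `k_m = 2^{-m}κ₀`, cut-off `= 1` on `B(ρ)` supported in
`B(λρ)`, through `hDG`; De Giorgi's isoperimetric inequality `deGiorgi_isoperimetric_ball_fin_three`
on a.e. slice; the telescoping `s·|{Φ<k_s}|² ≤ C δ₁⁻² |Q|²`.) [cite: NazarovUraltseva2012, Lemma 3.3, Remark 9] -/
theorem lemma22_shrinking :
    ∀ (lamlo θlo θhi μ δ₁ : ℝ) (N : ℝ≥0), 1 < lamlo → lamlo ≤ 2 → 0 < θlo → θlo ≤ θhi →
      0 < μ → μ < 1 → 0 < δ₁ →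
    ∃ s : ℕ,
    ∀ (Φ : ℝ → E3 → ℝ) (U : ℝ → E3 → E3) (S : Set (ℝ × E3)) (k R : ℝ),
      Standing Φ U S k R N →
    ∀ (lam ρ θ t₀ κ₀ : ℝ), lamlo ≤ lam → lam ≤ 2 → R / 4 ≤ ρ → lam * ρ ≤ 2 * R → θlo ≤ θ → θ ≤ θhi →
      t₀ ≤ 0 → -R ^ 2 < t₀ - θ * ρ ^ 2 → 0 < κ₀ → κ₀ ≤ k →
      (∀ᵐ t ∂(volume.restrict (Ioo (t₀ - θ * ρ ^ 2) t₀)),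
        ENNReal.ofReal δ₁ * volume (ball (0 : E3) ρ)
          ≤ volume {x : E3 | x ∈ ball (0 : E3) ρ ∧ κ₀ ≤ Φ t x}) →
      volume {z : ℝ × E3 | z ∈ Ioo (t₀ - θ * ρ ^ 2) t₀ ×ˢ ball (0 : E3) ρ ∧
          Φ z.1 z.2 < (2 : ℝ)⁻¹ ^ s * κ₀}
        ≤ ENNReal.ofReal μ * volume (Ioo (t₀ - θ * ρ ^ 2) t₀ ×ˢ ball (0 : E3) ρ) := by
  sorry

/-! ### The composition (L22-C proper): Cor 3.2′, Lemma 3.4′, Cor 3.3′ — proved in the landed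
files from the three atoms above (written out as hypotheses there). Target shape promised to
seat a (consumer: the final `hWH′` assembly, N–U Lemma 4.2 after (4.6)): -/

/-- **Cor 3.3′ = L22-C «expansion of positivity» (target statement; proof = N–U Cor 3.2(1) +
Lemma 3.4 from the atoms, in the landed file).** For a density `δ > 0` and a drift constant `N`
there is `β₃ > 0` such that, under the standing hypotheses at scale `R` and axis level `k`, for
every level `0 < κ ≤ k` (N–U apply it with `κ = ϰk`): if the superlevel set `{Φ > κ}` has
space–time measure at least `δ R⁵` inside `[-R², -¾R²] × B(R)`, then `Φ ≥ β₃ κ` a.e. on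
`Q(R/2) = ]-R²/4, 0[ × B(R/2)`. (The time `t̄`
with a dense slice — N–U «for some `t̄ ∈ [-R², -¾R²]`» — is selected INSIDE the proof, so that it
can be intersected with the good-slice set.) [cite: NazarovUraltseva2012, Cor 3.3 and the end of the proof of Lemma 4.2] -/
theorem lemma22_expansionOfPositivity :
    ∀ (δ : ℝ) (N : ℝ≥0), 0 < δ →
    ∃ β₃ : ℝ, 0 < β₃ ∧
    ∀ (Φ : ℝ → E3 → ℝ) (U : ℝ → E3 → E3) (S : Set (ℝ × E3)) (k R : ℝ),
      Standing Φ U S k R N →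
    ∀ (κ : ℝ), 0 < κ → κ ≤ k →
      ENNReal.ofReal (δ * R ^ 5)
        ≤ volume {z : ℝ × E3 | z ∈ Icc (-R ^ 2) (-(3 / 4) * R ^ 2) ×ˢ ball (0 : E3) R ∧
            κ < Φ z.1 z.2} →
      ∀ᵐ z ∂(volume.restrict (parabolicCylinder (R / 2) (0 : ℝ × E3))), β₃ * κ ≤ Φ z.1 z.2 := by
  sorry

end Summit.NavierStokesRegularity.NavierStokesRegularity.Cruxes.AxisymmetricKatoGlobal.Seregin2020Lemma22

end
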